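import Literature.Probability.RandomPlanarGeometry.HexSAWBrickWallPieces
import HarnessLib

/-!
# Honeycomb polygons from bridges, II: a six-step tail making bridge endpoints generic

Topic `Literature/Probability/RandomPlanarGeometry` (lane «pcv-sawmu», door «HEX-SAP» `μ_polygon(ℍ) = μ_ℍ`;
continues `HexSAWBrickWallPieces.lean`).  Source frame: N. Madras, G. Slade, *The Self-Avoiding Walk* (1993),
§1.2 ("The concatenation of two bridges will always yield another bridge", eq. (1.2.15)) and §3.2, proof of
Theorem 3.2.4 (the classes `B[M,x]` of bridges by endpoint).  The gluing of two half-plane pieces of the same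
class `(y, s)` into a honeycomb polygon (sequel `HexSAWBrickWallPolygonGlue.lean`) needs the common endpoint `y`
to have `y₁ ≠ 0` (so that a horizontal closing bond `e` with `φ_y(e) ≠ 0` exists) and `y₀ ≥ 6` (so that the two
staircase connectors are disjoint); both are arranged here, at the cost of six steps, by appending to every
bridge a fixed tail chosen by its endpoint: six steps `+e₀` if `x₁ ≠ 0`, else `+e₀,−e₁,+e₀,+e₀,+e₀,+e₀`.

## Contents (namespace `Literature.Probability.RandomPlanarGeometry.SAW.HexBW`, all PROVED)

* `tailA`, `tailB`, `tailFn`, `tail6 M ω = ω · T(ω(M))` (the tree's `Zd.concatWalk`), `tail6_mem_bridges`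
  (`∈ bridges (M+6)` for `ω ∈ bridges M`, `M` even), `tail6_apply_of_le`, `tail6_end_one_ne_zero`,
  `le_tail6_end_zero`, `tail6_injOn`;
* `goodBridges n` (bridges with endpoint `y`, `y₁ ≠ 0`, `y₀ ≥ 6`) and
  **`card_bridges_le_card_goodBridges`**: `b_M(ℍ) ≤ #goodBridges (M + 6)` for even `M ≥ 1`.
-/

noncomputable section

open Finset Function Literature.Probability.LatticeModels Literature.Probability.Percolation SimpleGraph

namespace Literature.Probability.RandomPlanarGeometry.SAW

namespace HexBW

-- Membership in the tree's finset `Zd.saws 2 n` must never be unfolded by the elaborator: for a numeral `n`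
-- the definitional unfolding evaluates the finset and times out.  We only ever use `Zd.mem_saws`.
attribute [local irreducible] Zd.saws

variable {M : ℕ} {ω : ℕ → Site 2}

/-! ### A six-step tail making the endpoint generic -/

/-- The straight tail of six steps `+e₀` read from `0`, frozen after time `6`. [cite: MadrasSlade1993, §1.2 (concatenation of bridges)] -/
def tailA (k : ℕ) : Site 2 := ![((min k 6 : ℕ) : ℤ), 0]

/-- The bent tail `+e₀, −e₁, +e₀, +e₀, +e₀, +e₀` read from `0`, frozen after time `6`. [cite: MadrasSlade1993, §1.2 (concatenation of bridges)] -/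
def tailB : ℕ → Site 2
  | 0 => 0
  | 1 => ![1, 0]
  | 2 => ![1, -1]
  | 3 => ![2, -1]
  | 4 => ![3, -1]
  | 5 => ![4, -1]
  | _ => ![5, -1]

/-- The tail read from `0`, chosen by the endpoint `x` of the bridge: the straight tail if `x₁ ≠ 0`, else the
bent one (so that the new endpoint has non-zero second coordinate). [cite: MadrasSlade1993, §1.2 (concatenation of bridges)] -/
def tailFn (x : Site 2) : ℕ → Site 2 := if x 1 ≠ 0 then tailA else tailB

/-- **The tailed bridge** `ω · T(ω(M))`, an `(M+6)`-step walk. [cite: MadrasSlade1993, §1.2 (concatenation of bridges)] -/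
def tail6 (M : ℕ) (ω : ℕ → Site 2) : ℕ → Site 2 := Zd.concatWalk M ω (tailFn (ω M))

/-- Values of the straight tail. [cite: MadrasSlade1993, §1.2, eq. (1.2.15) (concatenation of bridges)] -/
@[simp] theorem tailA_apply_zero (k : ℕ) : tailA k 0 = ((min k 6 : ℕ) : ℤ) := by
  simp [tailA]

/-- Values of the straight tail. [cite: MadrasSlade1993, §1.2, eq. (1.2.15) (concatenation of bridges)] -/
@[simp] theorem tailA_apply_one (k : ℕ) : tailA k 1 = 0 := by
  simp [tailA]

/-- The bent tail is frozen after time `6`. [cite: MadrasSlade1993, §1.2, eq. (1.2.15) (concatenation of bridges)] -/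
theorem tailB_of_ge {k : ℕ} (hk : 6 ≤ k) : tailB k = ![5, -1] := by
  obtain ⟨j, rfl⟩ : ∃ j, k = j + 6 := ⟨k - 6, by omega⟩
  simp [tailB]

/-- The straight tail is frozen after time `6`. [cite: MadrasSlade1993, §1.2, eq. (1.2.15) (concatenation of bridges)] -/
theorem tailA_of_ge {k : ℕ} (hk : 6 ≤ k) : tailA k = tailA 6 := by
  simp [tailA, min_eq_right hk]

/-- The tail is frozen after time `6`. [cite: MadrasSlade1993, §1.2, eq. (1.2.15) (concatenation of bridges)] -/
theorem tailFn_of_ge (x : Site 2) {k : ℕ} (hk : 6 ≤ k) : tailFn x k = tailFn x 6 := by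
  unfold tailFn
  split_ifs
  · exact tailA_of_ge hk
  · rw [tailB_of_ge hk, tailB_of_ge le_rfl]

/-- The tail starts at `0`. [cite: MadrasSlade1993, §1.2, eq. (1.2.15) (concatenation of bridges)] -/
theorem tailFn_zero (x : Site 2) : tailFn x 0 = 0 := by
  unfold tailFn
  split_ifs
  · funext j
    fin_cases j <;> simp [tailA]
  · rfl

/-- The height along the tail for `1 ≤ k ≤ 6`: between `1` and the final height. [cite: MadrasSlade1993, §1.2, eq. (1.2.15) (concatenation of bridges)] -/
theorem tailFn_apply_zero_bounds_of_le (x : Site 2) {k : ℕ} (hk : 1 ≤ k) (hk4 : k ≤ 6) :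
    1 ≤ tailFn x k 0 ∧ tailFn x k 0 ≤ tailFn x 6 0 := by
  unfold tailFn
  split_ifs
  · simp only [tailA_apply_zero]
    omega
  · interval_cases k <;> simp [tailB]

/-- The height along the tail: `1, …, 6` or `1, 1, 2, 3, 4, 5`; in either case between `1` and the final height.
[cite: MadrasSlade1993, §1.2, eq. (1.2.15) (concatenation of bridges)] -/
theorem tailFn_apply_zero_bounds (x : Site 2) {k : ℕ} (hk : 1 ≤ k) :
    1 ≤ tailFn x k 0 ∧ tailFn x k 0 ≤ tailFn x 6 0 := by
  rcases le_or_gt k 6 with h4 | h4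
  · exact tailFn_apply_zero_bounds_of_le x hk h4
  · rw [tailFn_of_ge x h4.le]
    exact tailFn_apply_zero_bounds_of_le x (by omega) le_rfl

/-- The final height of the tail is at least `5`. [cite: MadrasSlade1993, §1.2, eq. (1.2.15) (concatenation of bridges)] -/
theorem five_le_tailFn_six_zero (x : Site 2) : 5 ≤ tailFn x 6 0 := by
  unfold tailFn
  split_ifs
  · simp
  · simp [tailB]

/-- The final second coordinate of the tail makes `x₁ + T₁ ≠ 0`. [cite: MadrasSlade1993, §1.2, eq. (1.2.15) (concatenation of bridges)] -/
theorem add_tailFn_six_one_ne_zero (x : Site 2) : x 1 + tailFn x 6 1 ≠ 0 := by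
  unfold tailFn
  split_ifs with h
  · simpa using h
  · push Not at h
    simp [tailB, h]

/-- **The steps of the tail, placed at a site `x` of even parity, are brick-wall bonds.** [cite: EntingJensen2009, §7.4.2, Fig. 7.10 (brickwork form of the honeycomb lattice)] -/
theorem adj_add_tailFn {x : Site 2} (hx : (x 0 + x 1) % 2 = 0) {k : ℕ} (hk : k < 6) :
    brickWallGraph.Adj (x + tailFn x k) (x + tailFn x (k + 1)) := by
  rw [brickWallGraph_adj_coord]
  have e1 : ((min k 6 : ℕ) : ℤ) = k := by rw [min_eq_left hk.le]
  have e2 : ((min (k + 1) 6 : ℕ) : ℤ) = k + 1 := by rw [min_eq_left (Nat.succ_le_of_lt hk)]; push_cast; ring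
  unfold tailFn
  split_ifs
  · simp only [Pi.add_apply, tailA_apply_zero, tailA_apply_one, e1, e2, add_zero, and_true]
    omega
  · interval_cases k <;> simp [tailB] <;> omega

/-- The invariant `T(k)₀ − T(k)₁ = min k 6` of both tails. [cite: MadrasSlade1993, §1.2, eq. (1.2.15) (concatenation of bridges)] -/
theorem tailFn_apply_zero_sub_apply_one (x : Site 2) (k : ℕ) :
    tailFn x k 0 - tailFn x k 1 = ((min k 6 : ℕ) : ℤ) := by
  unfold tailFn
  split_ifs
  · simp
  · rcases le_or_gt k 5 with hk | hk
    · interval_cases k <;> simp [tailB]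
    · rw [tailB_of_ge (by omega), min_eq_right (by omega)]
      simp

/-- The tail is injective on `[0, 6]`. [cite: MadrasSlade1993, §1.2, eq. (1.2.15) (concatenation of bridges)] -/
theorem tailFn_injOn (x : Site 2) : Set.InjOn (tailFn x) {i | i ≤ 6} := by
  intro i hi j hj hij
  simp only [Set.mem_setOf_eq] at hi hj
  have h := tailFn_apply_zero_sub_apply_one x i
  rw [hij, tailFn_apply_zero_sub_apply_one x j, min_eq_left hi, min_eq_left hj] at h
  exact_mod_cast h.symm

/-- The tail is a `ℤ²` self-avoiding walk from `0` of length `6`. [cite: MadrasSlade1993, §1.2, eq. (1.2.15) (concatenation of bridges)] -/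
theorem tailFn_mem_zd_saws (x : Site 2) (hx : (x 0 + x 1) % 2 = 0) : tailFn x ∈ Zd.saws 2 6 := by
  rw [Zd.mem_saws]
  refine ⟨tailFn_zero x, fun i hi => tailFn_of_ge x hi, fun i hi => ?_, tailFn_injOn x⟩
  have := adj_add_tailFn hx hi
  rw [adj_add_left_iff_of_even hx] at this
  exact zd_adj_of_adj this

/-- The tailed walk agrees with `ω` up to time `M`. [cite: MadrasSlade1993, §1.2, eq. (1.2.15) (concatenation of bridges)] -/
theorem tail6_apply_of_le {k : ℕ} (hk : k ≤ M) : tail6 M ω k = ω k := by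
  simp only [tail6, Zd.concatWalk, if_pos hk]

/-- The tailed walk after time `M`. [cite: MadrasSlade1993, §1.2, eq. (1.2.15) (concatenation of bridges)] -/
theorem tail6_apply_of_lt {k : ℕ} (hk : M < k) : tail6 M ω k = ω M + tailFn (ω M) (k - M) := by
  simp only [tail6, Zd.concatWalk, if_neg (Nat.not_le.2 hk)]

/-- The endpoint of the tailed walk. [cite: MadrasSlade1993, §1.2, eq. (1.2.15) (concatenation of bridges)] -/
theorem tail6_apply_end (M : ℕ) (ω : ℕ → Site 2) : tail6 M ω (M + 6) = ω M + tailFn (ω M) 6 := by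
  rw [tail6_apply_of_lt (by omega), show M + 6 - M = 6 by omega]

/-- **The tailed bridge is a honeycomb bridge of length `M + 6`** (the tail climbs strictly above the old
maximal height and ends at the new maximum). [cite: MadrasSlade1993, §1.2, eq. (1.2.15) (concatenation of bridges)] -/
theorem tail6_mem_bridges (hω : ω ∈ bridges M) (hM : M % 2 = 0) : tail6 M ω ∈ bridges (M + 6) := by
  obtain ⟨hωs, hb⟩ := mem_bridges.1 hω
  obtain ⟨h0, hend, hbw, hinj⟩ := mem_saws_iff.1 hωs
  have hx : (ω M 0 + ω M 1) % 2 = 0 := by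
    rw [parity_apply hωs le_rfl]
    exact_mod_cast hM
  have h00 : ω 0 0 = 0 := by rw [h0]; rfl
  -- heights of `ω` are at most `x₀`, and `x₀ ≥ 0`
  have hxnn : 0 ≤ ω M 0 := by
    rcases Nat.eq_zero_or_pos M with rfl | hMpos
    · rw [h00]
    · exact (h00 ▸ (hb M hMpos le_rfl).1).le
  have hle : ∀ i ≤ M, ω i 0 ≤ ω M 0 := fun i hi => by
    rcases Nat.eq_zero_or_pos i with rfl | hipos
    · rw [h00]; exact hxnn
    · exact (hb i hipos hi).2
  have hsep : ∀ i ≤ M, ∀ j, 1 ≤ j → j ≤ 6 → ω i ≠ ω M + tailFn (ω M) j := by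
    intro i hi j hj1 hj4 heq
    have h1 := congrFun heq 0
    simp only [Pi.add_apply] at h1
    have := (tailFn_apply_zero_bounds (ω M) hj1).1
    have := hle i hi
    omega
  -- (membership in `Zd.saws` is unfolded at once: a definitional comparison of `_ ∈ Zd.saws 2 (M + 6)`
  -- statements makes the elaborator evaluate the finset and time out)
  have hzd := Zd.concatWalk_mem_saws (saws_subset M hωs) (tailFn_mem_zd_saws (ω M) hx) hsep
  rw [Zd.mem_saws] at hzd
  rw [mem_bridges, mem_saws, Zd.mem_saws]
  refine ⟨⟨hzd, fun k hk => ?_⟩, fun i hi1 hi2 => ?_⟩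
  · -- brick-wall steps
    by_cases h1 : k + 1 ≤ M
    · rw [tail6_apply_of_le (by omega), tail6_apply_of_le h1]
      exact hbw k (by omega)
    · rw [tail6_apply_of_lt (by omega : M < k + 1)]
      by_cases h2 : k ≤ M
      · have hkM : k = M := by omega
        subst hkM
        rw [tail6_apply_of_le le_rfl, show k + 1 - k = 0 + 1 by omega]
        have := adj_add_tailFn hx (show 0 < 6 by omega)
        rwa [tailFn_zero, add_zero] at this
      · rw [tail6_apply_of_lt (by omega : M < k), show k + 1 - M = (k - M) + 1 by omega]
        exact adj_add_tailFn hx (by omega)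
  · -- the bridge condition
    rw [tail6_apply_of_le (Nat.zero_le _), h00, tail6_apply_end, Pi.add_apply]
    have h4 := (tailFn_apply_zero_bounds (ω M) (show 1 ≤ 6 by omega)).1
    by_cases h1 : i ≤ M
    · rw [tail6_apply_of_le h1]
      have := hb i hi1 h1
      rw [h00] at this
      have := hle i h1
      exact ⟨by omega, by omega⟩
    · rw [tail6_apply_of_lt (by omega), Pi.add_apply]
      have := tailFn_apply_zero_bounds (ω M) (show 1 ≤ i - M by omega)
      rw [tailFn_of_ge (ω M) (show 6 ≤ 6 from le_rfl)] at this
      have h5 : tailFn (ω M) (i - M) 0 ≤ tailFn (ω M) 6 0 := by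
        rcases le_or_gt (i - M) 6 with h6 | h6
        · exact this.2
        · rw [tailFn_of_ge (ω M) h6.le]
      exact ⟨by omega, by omega⟩

/-- The endpoint of the tailed bridge has non-zero second coordinate. [cite: MadrasSlade1993, §1.2, eq. (1.2.15) (concatenation of bridges)] -/
theorem tail6_end_one_ne_zero (M : ℕ) (ω : ℕ → Site 2) : tail6 M ω (M + 6) 1 ≠ 0 := by
  rw [tail6_apply_end, Pi.add_apply]
  exact add_tailFn_six_one_ne_zero (ω M)

/-- The endpoint of the tailed bridge is at least `5` higher than the old one. [cite: MadrasSlade1993, §1.2, eq. (1.2.15) (concatenation of bridges)] -/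
theorem le_tail6_end_zero (M : ℕ) (ω : ℕ → Site 2) : ω M 0 + 5 ≤ tail6 M ω (M + 6) 0 := by
  rw [tail6_apply_end, Pi.add_apply]
  have := five_le_tailFn_six_zero (ω M)
  omega

/-- **The tail map is injective** on walks frozen after time `M`. [cite: MadrasSlade1993, §1.2, eq. (1.2.15) (concatenation of bridges)] -/
theorem tail6_injOn : Set.InjOn (tail6 M) ↑(bridges M) := by
  intro ω hω ξ hξ h
  have hωe := (Zd.mem_saws.1 (Zd.mem_bridges.1 (bridges_subset_zd M hω)).1).2.1
  have hξe := (Zd.mem_saws.1 (Zd.mem_bridges.1 (bridges_subset_zd M hξ)).1).2.1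
  funext k
  rcases le_or_gt k M with hk | hk
  · have := congrFun h k
    rwa [tail6_apply_of_le hk, tail6_apply_of_le hk] at this
  · have := congrFun h M
    rw [tail6_apply_of_le le_rfl, tail6_apply_of_le le_rfl] at this
    rw [hωe k hk.le, hξe k hk.le, this]

open Classical in
/-- **The good bridges**: endpoint `y` with `y₁ ≠ 0` and `y₀ ≥ 6`. [cite: MadrasSlade1993, §3.2 (proof of Theorem 3.2.4: the classes `B[M,x]`)] -/
def goodBridges (n : ℕ) : Finset (ℕ → Site 2) := (bridges n).filter fun ω => ω n 1 ≠ 0 ∧ 6 ≤ ω n 0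

/-- Membership in `goodBridges`. [cite: MadrasSlade1993, §1.2, eq. (1.2.15) (concatenation of bridges)] -/
theorem mem_goodBridges {n : ℕ} {ω : ℕ → Site 2} :
    ω ∈ goodBridges n ↔ ω ∈ bridges n ∧ ω n 1 ≠ 0 ∧ 6 ≤ ω n 0 := by
  classical
  exact Finset.mem_filter

/-- **`b_M(ℍ) ≤ #goodBridges (M + 6)`** for even `M ≥ 1` (the tail map). [cite: MadrasSlade1993, §1.2, eq. (1.2.15)] -/
theorem card_bridges_le_card_goodBridges (hM1 : 1 ≤ M) (hM : M % 2 = 0) :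
    bridgeCount M ≤ #(goodBridges (M + 6)) := by
  rw [bridgeCount]
  refine Finset.card_le_card_of_injOn (tail6 M) (fun ω hω => ?_) tail6_injOn
  rw [Finset.mem_coe, mem_goodBridges]
  refine ⟨tail6_mem_bridges hω hM, tail6_end_one_ne_zero M ω, ?_⟩
  obtain ⟨hωs, hb⟩ := mem_bridges.1 hω
  have h00 : ω 0 0 = 0 := by rw [(mem_saws_iff.1 hωs).1]; rfl
  have := (hb M hM1 le_rfl).1
  rw [h00] at this
  have := le_tail6_end_zero M ω
  omega

end HexBW

end Literature.Probability.RandomPlanarGeometry.SAW
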